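import Mathlib
import Summits.CriticalPhenomena.SAWScalingLimit.Theorems.SAWRestrictionRigidityAxiomsOfLimitMarkovSoftMarkov
import Summits.CriticalPhenomena.SAWScalingLimit.Theorems.SAWRestrictionRigidityAxiomsOfLimitMarkovMarkovInitial
import Literature.Probability.RandomPlanarGeometry.ChordalCurveFamily
import Literature.Probability.RandomPlanarGeometry.ChordalRestrictionMarkov
import HarnessLib

/-!
# The domain-Markov extension from the soft-Markov theorem (bookkeeping brick D3)

Crux `AxiomsOfLimit` (stmt-CriticalPhenomena-1370), line `registered`, stub `stub_markovOfLimit`,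
brick D3 "the domain-Markov extension from the soft-Markov theorem" (lead c4). Theorems only.

From the class-level soft-Markov theorem (hypothesis, landed as `stub_softMarkovAllF`),
configuration rigidity of typical proper pasts and the slit-not-Jordan statement (hypotheses,
the neighbouring bricks), every chordal family `P` carried by simple boundary-avoiding curves whose
laws depend on the Dobrushin domain only through `(carrier, pt 0, pt 1)` admits a kernel `Q` with
`P.IsMarkovExtension Q`. The kernel is DEFINED through configurations: `Q D p := Φ (remainingDomain
D p, p.target, D.pt 1)`, where `Φ (U, x, b)` is the Dirac mass at the constant class `b` if
`x = b`, else the soft-Markov kernel of a typical proper past with configuration `(U, x, b)` if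
there is one, else `P D'` for a Dobrushin domain `D'` with `(carrier, pt 0, pt 1) = (U, x, b)` if
there is one, else `0`. The clause `domain` is then free, `initial` is the slit-not-Jordan
statement, and `markov` follows from the soft-Markov disintegration: above a typical proper past
the rigidity hypothesis identifies `Φ` with the soft-Markov kernel, and above a past already at
`b` the future is trivial.

References: W. Werner, *Lectures on two-dimensional critical percolation* (2007) §3.2 (2);
O. Schramm, Israel J. Math. 118 (2000) §1. All [folklore].
-/

noncomputable section

open MeasureTheory Filter Set
open scoped ENNReal

namespace Summit.CriticalPhenomena.SAWScalingLimit.Theorems.AxiomsOfLimitMarkov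

open Literature.Probability.RandomPlanarGeometry

/-! ### Helper lemmas -/

/-- A curve not starting in the closed set `F` has positive hitting parameter. [folklore] -/
theorem MarkovExt.hitParam_pos {F : Set ℂ} (hF : IsClosed F) {γ : Curve ℂ} (h0 : γ 0 ∉ F) :
    0 < γ.hitParam F := by
  refine lt_of_le_of_ne (γ.hitParam_mem_Icc F).1 fun h => ?_
  by_cases hex : ∃ t, γ t ∈ F
  · refine h0 ?_
    have h1 : (0 : unitInterval) = ⟨γ.hitParam F, γ.hitParam_mem_Icc F⟩ := Subtype.ext h
    rw [h1]
    exact Curve.apply_hitParam_mem hF hex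
  · rw [Curve.hitParam_eq_one_of_forall_notMem (not_exists.1 hex)] at h
    exact zero_ne_one h

/-- **Typical proper pasts.** The past at a closed set `F` of a simple curve from `D.pt 0` to
`D.pt 1` in `closure D`, meeting the frontier only at the marked points, not starting in `F` and
whose past does not end at `D.pt 1`, is a typical proper past: a simple arc from `D.pt 0` whose
other points (tip included) lie in the open carrier. [folklore] -/
theorem MarkovExt.ts_stopAt {F : Set ℂ} (hF : IsClosed F) (D : DobrushinDomain) {γ : Curve ℂ}
    (hγ : Function.Injective γ) (hsrc : (CurveClass.mk γ).source = D.pt 0)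
    (htgt : (CurveClass.mk γ).target = D.pt 1)
    (hcl : (CurveClass.mk γ).range ⊆ closure D.carrier)
    (hfr : (CurveClass.mk γ).range ∩ frontier D.carrier ⊆ {D.pt 0, D.pt 1}) (h0 : γ 0 ∉ F)
    (hne : (CurveClass.mk (γ.stopAt F)).target ≠ D.pt 1) :
    (∃ γ' : Curve ℂ, Function.Injective γ' ∧ CurveClass.mk γ' = CurveClass.mk (γ.stopAt F)) ∧
      (CurveClass.mk (γ.stopAt F)).source = D.pt 0 ∧
      (CurveClass.mk (γ.stopAt F)).target ∈ D.carrier ∧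
      ∀ z ∈ (CurveClass.mk (γ.stopAt F)).range, z ≠ D.pt 0 → z ∈ D.carrier := by
  have hh : 0 < γ.hitParam F := MarkovExt.hitParam_pos hF h0
  have hsrc' : γ 0 = D.pt 0 := hsrc
  have htgt' : γ 1 = D.pt 1 := htgt
  -- the stopped curve is `s ↦ γ (h s)`
  have hpt : ∀ s : unitInterval, ∃ u : unitInterval,
      (u : ℝ) = γ.hitParam F * s ∧ γ.stopAt F s = γ u := fun s =>
    ⟨_, congrArg Subtype.val (Set.projIcc_of_mem zero_le_one ⟨mul_nonneg hh.le s.2.1,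
      mul_le_one₀ (γ.hitParam_mem_Icc F).2 s.2.1 s.2.2⟩), Curve.stopAt_apply F γ s⟩
  -- points of the curve other than the marked points lie in the open carrier
  have hmem : ∀ u : unitInterval, γ u ≠ D.pt 0 → γ u ≠ D.pt 1 → γ u ∈ D.carrier := by
    intro u h1 h2
    by_contra hzD
    have hz : γ u ∈ closure D.carrier := hcl ⟨u, rfl⟩
    rw [closure_eq_self_union_frontier] at hz
    rcases hfr ⟨⟨u, rfl⟩, hz.resolve_left hzD⟩ with h | h
    exacts [h1 h, h2 h]
  -- no point of the stopped curve is the target `D.pt 1 = γ 1`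
  have hnb : ∀ s : unitInterval, γ.stopAt F s ≠ D.pt 1 := by
    intro s hs
    obtain ⟨u, hu, hsu⟩ := hpt s
    rw [hsu, ← htgt'] at hs
    have hu1 : (u : ℝ) = 1 := congrArg Subtype.val (hγ hs)
    have h1 : (1 : ℝ) ≤ γ.hitParam F := by
      rw [← hu1, hu]
      exact mul_le_of_le_one_right hh.le s.2.2
    refine hne ?_
    show γ.stopAt F 1 = D.pt 1
    rw [Curve.stopAt_eq_self_of_hitParam_eq_one (le_antisymm (γ.hitParam_mem_Icc F).2 h1)]
    exact htgt'
  refine ⟨⟨γ.stopAt F, fun s t hst => ?_, rfl⟩, ?_, ?_, fun z hz hz0 => ?_⟩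
  · obtain ⟨u, hu, hsu⟩ := hpt s
    obtain ⟨v, hv, htv⟩ := hpt t
    rw [hsu, htv] at hst
    have h := congrArg Subtype.val (hγ hst)
    rw [hu, hv] at h
    exact Subtype.ext (mul_left_cancel₀ hh.ne' h)
  · rw [CurveClass.source_mk, Curve.source_stopAt]
    exact hsrc
  · obtain ⟨u, hu, h1u⟩ := hpt 1
    show γ.stopAt F 1 ∈ D.carrier
    refine h1u ▸ hmem u (fun h => hh.ne' ?_) fun h => hnb 1 (h1u.trans h)
    rw [← hsrc'] at h
    have h' := congrArg Subtype.val (hγ h)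
    rwa [hu, Set.Icc.coe_one, mul_one] at h'
  · obtain ⟨s, rfl⟩ := hz
    obtain ⟨u, hu, hsu⟩ := hpt s
    rw [hsu] at hz0 ⊢
    exact hmem u hz0 fun h => hnb s (hsu.trans h)

/-! ### The theorem -/

/-- **The domain-Markov extension (registered stub `stub_isMarkovExtensionOfSoft2`).** From the
soft-Markov theorem on curve classes, configuration rigidity of typical proper pasts and the
slit-not-Jordan statement: every chordal family carried by simple boundary-avoiding curves whose
laws depend on the domain only through `(carrier, pt 0, pt 1)` admits `Q` with
`P.IsMarkovExtension Q` (initial, markov for every closed `F`, domain). [folklore] -/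
theorem stub_isMarkovExtensionOfSoft2 : (∀ (μ : MeasureTheory.Measure (Literature.Probability.RandomPlanarGeometry.CurveClass ℂ)) [MeasureTheory.IsProbabilityMeasure μ] (a b : ℂ) (R : ℝ), 0 < R → a ≠ b → Filter.Eventually (fun c : Literature.Probability.RandomPlanarGeometry.CurveClass ℂ => c ∈ Literature.Probability.RandomPlanarGeometry.CurveClass.simple ∧ c.range ⊆ Metric.ball (0:ℂ) R ∧ c.source = a ∧ c.target = b) (MeasureTheory.ae μ) → ∃ Q : Literature.Probability.RandomPlanarGeometry.CurveClass ℂ → MeasureTheory.Measure (Literature.Probability.RandomPlanarGeometry.CurveClass ℂ), Q (Literature.Probability.RandomPlanarGeometry.CurveClass.mk (Literature.Probability.RandomPlanarGeometry.Curve.const a)) = μ ∧ ∀ F : Set ℂ, IsClosed F → ∀ S T : Set (Literature.Probability.RandomPlanarGeometry.CurveClass ℂ), MeasurableSet S → MeasurableSet T → μ (Literature.Probability.RandomPlanarGeometry.CurveClass.stopAt F ⁻¹' S ∩ Literature.Probability.RandomPlanarGeometry.CurveClass.startFrom F ⁻¹' T) = MeasureTheory.lintegral (μ.restrict (Literature.Probability.RandomPlanarGeometry.CurveClass.stopAt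 F ⁻¹' S)) (fun γ => Q (γ.stopAt F) T)) → (∀ (D₁ D₂ : Literature.Probability.RandomPlanarGeometry.DobrushinDomain) (p₁ p₂ : Literature.Probability.RandomPlanarGeometry.CurveClass ℂ), ((∃ γ : Literature.Probability.RandomPlanarGeometry.Curve ℂ, Function.Injective γ ∧ Literature.Probability.RandomPlanarGeometry.CurveClass.mk γ = p₁) ∧ (p₁).source = (D₁).pt 0 ∧ (p₁).target ∈ (D₁).carrier ∧ (∀ z ∈ (p₁).range, z ≠ (D₁).pt 0 → z ∈ (D₁).carrier)) → ((∃ γ : Literature.Probability.RandomPlanarGeometry.Curve ℂ, Function.Injective γ ∧ Literature.Probability.RandomPlanarGeometry.CurveClass.mk γ = p₂) ∧ (p₂).source = (D₂).pt 0 ∧ (p₂).target ∈ (D₂).carrier ∧ (∀ z ∈ (p₂).range, z ≠ (D₂).pt 0 → z ∈ (D₂).carrier)) → Literature.Probability.RandomPlanarGeometry.remainingDomain D₁ p₁ = Literature.Probability.RandomPlanarGeometry.remainingDomain D₂ p₂ → p₁.target = p₂.target → D₁.pt 1 = D₂.pt 1 → D₁.carrier = D₂.carrier ∧ D₁.pt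 0 = D₂.pt 0 ∧ p₁ = p₂) → (∀ (D D₂ : Literature.Probability.RandomPlanarGeometry.DobrushinDomain) (p₂ : Literature.Probability.RandomPlanarGeometry.CurveClass ℂ), ((∃ γ : Literature.Probability.RandomPlanarGeometry.Curve ℂ, Function.Injective γ ∧ Literature.Probability.RandomPlanarGeometry.CurveClass.mk γ = p₂) ∧ (p₂).source = (D₂).pt 0 ∧ (p₂).target ∈ (D₂).carrier ∧ (∀ z ∈ (p₂).range, z ≠ (D₂).pt 0 → z ∈ (D₂).carrier)) → Literature.Probability.RandomPlanarGeometry.remainingDomain D₂ p₂ ≠ D.carrier) → ∀ P : Literature.Probability.RandomPlanarGeometry.ChordalFamily, P.IsChordal → (∀ D : Literature.Probability.RandomPlanarGeometry.DobrushinDomain, Filter.Eventually (fun γ : Literature.Probability.RandomPlanarGeometry.CurveClass ℂ => γ ∈ Literature.Probability.RandomPlanarGeometry.CurveClass.simple ∧ γ.range ∩ frontier D.carrier ⊆ {D.pt 0, D.pt 1}) (MeasureTheory.ae (P D))) → (∀ D D' : Literature.Probability.RandomPlanarGeometry.DobrushinDomain, D.carrier = D'.carrier → D.pt 0 = D'.pt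 0 → D.pt 1 = D'.pt 1 → P D = P D') → ∃ Q : Literature.Probability.RandomPlanarGeometry.DobrushinDomain → Literature.Probability.RandomPlanarGeometry.CurveClass ℂ → MeasureTheory.Measure (Literature.Probability.RandomPlanarGeometry.CurveClass ℂ), P.IsMarkovExtension Q := by
  intro hSoft hRig hSlit P hch h6 hdep
  classical
  -- (1) the soft-Markov kernels, as a function of (law, starting point) only
  obtain ⟨q, hq⟩ : ∃ q : Measure (CurveClass ℂ) → ℂ → CurveClass ℂ → Measure (CurveClass ℂ),
      ∀ D : DobrushinDomain, q (P D) (D.pt 0) (CurveClass.mk (Curve.const (D.pt 0))) = P D ∧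
        ∀ F : Set ℂ, IsClosed F → ∀ S T : Set (CurveClass ℂ), MeasurableSet S →
          MeasurableSet T →
          P D (CurveClass.stopAt F ⁻¹' S ∩ CurveClass.startFrom F ⁻¹' T) =
            ∫⁻ γ in CurveClass.stopAt F ⁻¹' S, q (P D) (D.pt 0) (γ.stopAt F) T ∂(P D) := by
    have key : ∀ (μ : Measure (CurveClass ℂ)) (a : ℂ),
        ∃ Q : CurveClass ℂ → Measure (CurveClass ℂ), ∀ D : DobrushinDomain, P D = μ → D.pt 0 = a →
          Q (CurveClass.mk (Curve.const (D.pt 0))) = P D ∧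
            ∀ F : Set ℂ, IsClosed F → ∀ S T : Set (CurveClass ℂ), MeasurableSet S →
              MeasurableSet T →
              P D (CurveClass.stopAt F ⁻¹' S ∩ CurveClass.startFrom F ⁻¹' T) =
                ∫⁻ γ in CurveClass.stopAt F ⁻¹' S, Q (γ.stopAt F) T ∂(P D) := by
      intro μ a
      by_cases hex : ∃ D : DobrushinDomain, P D = μ ∧ D.pt 0 = a
      · obtain ⟨D, rfl, rfl⟩ := hex
        obtain ⟨Q, hQ⟩ := exists_markovKernel_of_isChordal_of_simple hSoft P hch h6 D
        refine ⟨Q, fun D' hP ha => ?_⟩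
        rw [hP, ha]
        exact hQ
      · exact ⟨fun _ => 0, fun D hP ha => (hex ⟨D, hP, ha⟩).elim⟩
    choose q hq using key
    exact ⟨q, fun D => hq (P D) (D.pt 0) D rfl rfl⟩
  -- (2) the kernel as a function of the configuration (remaining domain, tip, target)
  obtain ⟨Φ, hΦ⟩ : ∃ Φ : Set ℂ → ℂ → ℂ → Measure (CurveClass ℂ), ∀ U x y, Φ U x y =
      if x = y then Measure.dirac (CurveClass.mk (Curve.const y)) else
        if h : ∃ Dp : DobrushinDomain × CurveClass ℂ,
            ((∃ γ : Curve ℂ, Function.Injective γ ∧ CurveClass.mk γ = Dp.2) ∧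
              Dp.2.source = Dp.1.pt 0 ∧ Dp.2.target ∈ Dp.1.carrier ∧
                ∀ z ∈ Dp.2.range, z ≠ Dp.1.pt 0 → z ∈ Dp.1.carrier) ∧
            remainingDomain Dp.1 Dp.2 = U ∧ Dp.2.target = x ∧ Dp.1.pt 1 = y
        then q (P h.choose.1) (h.choose.1.pt 0) h.choose.2 else
          if h' : ∃ D : DobrushinDomain, D.carrier = U ∧ D.pt 0 = x ∧ D.pt 1 = y then P h'.choose
          else 0 := ⟨_, fun _ _ _ => rfl⟩
  -- (3) INITIAL: the configuration of the trivial past is `(D.carrier, pt 0, pt 1)`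
  have hinit : ∀ D : DobrushinDomain, Φ (remainingDomain D (CurveClass.mk (Curve.const (D.pt 0))))
      (CurveClass.mk (Curve.const (D.pt 0))).target (D.pt 1) = P D := by
    intro D
    have hab : D.pt 0 ≠ D.pt 1 := fun h => absurd (D.pt_injective h) (by decide)
    rw [remainingDomain_mk_const, CurveClass.target_mk, Curve.target_def, Curve.const_apply,
      hΦ, if_neg hab]
    split_ifs with h₁ h₂
    · obtain ⟨hTS, hU, -, -⟩ := h₁.choose_spec
      exact (hSlit D _ _ hTS hU).elim
    · obtain ⟨h1, h2, h3⟩ := h₂.choose_spec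
      exact hdep _ _ h1 h2 h3
    · exact (h₂ ⟨D, rfl, rfl, rfl⟩).elim
  refine ⟨fun D p => Φ (remainingDomain D p) p.target (D.pt 1), fun D => hinit D,
    fun D F hF S T hS hT => ?_, fun D₁ D₂ p₁ p₂ h1 h2 h3 => ?_⟩
  swap
  · show Φ _ _ _ = Φ _ _ _
    rw [h1, h2, h3]
  -- (4) MARKOV
  have hst : Measurable (CurveClass.stopAt F : CurveClass ℂ → CurveClass ℂ) :=
    CurveClass.measurable_stopAt hF
  have hB : MeasurableSet {c : CurveClass ℂ | c.target = D.pt 1} :=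
    CurveClass.continuous_target.measurable (measurableSet_singleton _)
  -- typical curves: above a proper past `Φ` is the soft-Markov kernel, above a past already at
  -- `D.pt 1` the future is trivial
  have hAE : ∀ᵐ γ ∂P D, ((γ.stopAt F).target ≠ D.pt 1 →
      Φ (remainingDomain D (γ.stopAt F)) (γ.stopAt F).target (D.pt 1) =
        q (P D) (D.pt 0) (γ.stopAt F)) ∧
      ((γ.stopAt F).target = D.pt 1 → γ.startFrom F = CurveClass.mk (Curve.const (D.pt 1))) := by
    filter_upwards [(hch D).2, h6 D] with γ hc h6c
    obtain ⟨hsrc, htgt, hcl⟩ := hc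
    obtain ⟨hsim, hfr⟩ := h6c
    refine ⟨fun hne => ?_, fun he => by
      rw [SoftMarkov.startFrom_eq_of_target_stopAt hF hsim (he.trans htgt.symm), htgt]⟩
    obtain ⟨γ₀, hγ₀, rfl⟩ := hsim
    by_cases h0 : γ₀ 0 ∈ F
    · have h0' : γ₀ 0 = D.pt 0 := hsrc
      rw [(SoftMarkov.stopAt_mk_of_mem hF γ₀ h0).1, h0', hinit D, (hq D).1]
    · rw [CurveClass.stopAt_mk_holds F hF] at hne ⊢
      have hTS := MarkovExt.ts_stopAt hF D hγ₀ hsrc htgt hcl hfr h0 hne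
      rw [hΦ, if_neg hne]
      split_ifs with h₁ h₂
      · obtain ⟨hTS', hU, hx, hb⟩ := h₁.choose_spec
        obtain ⟨hcar, hpt, hp⟩ := hRig _ D _ (CurveClass.mk (γ₀.stopAt F)) hTS' hTS hU hx hb
        rw [hp, hpt, hdep _ D hcar hpt hb]
      · exact (h₁ ⟨(D, CurveClass.mk (γ₀.stopAt F)), hTS, rfl, rfl, rfl⟩).elim
      · exact (h₁ ⟨(D, CurveClass.mk (γ₀.stopAt F)), hTS, rfl, rfl, rfl⟩).elim
  -- split `S` according to whether the past already ends at `D.pt 1`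
  have hS₁ : MeasurableSet (CurveClass.stopAt F ⁻¹' (S \ {c | c.target = D.pt 1})) :=
    (hS.diff hB).preimage hst
  have hS₂ : MeasurableSet (CurveClass.stopAt F ⁻¹' (S ∩ {c | c.target = D.pt 1})) :=
    (hS.inter hB).preimage hst
  have hdj : Disjoint (CurveClass.stopAt F ⁻¹' (S \ {c | c.target = D.pt 1}))
      (CurveClass.stopAt F ⁻¹' (S ∩ {c | c.target = D.pt 1})) :=
    Set.disjoint_sdiff_inter.preimage _
  have hsplit : CurveClass.stopAt F ⁻¹' S = CurveClass.stopAt F ⁻¹' (S \ {c | c.target = D.pt 1}) ∪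
      CurveClass.stopAt F ⁻¹' (S ∩ {c | c.target = D.pt 1}) := by
    rw [← Set.preimage_union, Set.sdiff_union_inter]
  rw [hsplit, Set.union_inter_distrib_right, measure_union (hdj.mono inter_subset_left
    inter_subset_left) (hS₂.inter (hT.preimage (CurveClass.measurable_startFrom hF))),
    lintegral_union hS₂ hdj]
  congr 1
  · -- proper pasts: the soft-Markov disintegration
    rw [(hq D).2 F hF _ T (hS.diff hB) hT]
    exact setLIntegral_congr_fun_ae hS₁ (hAE.mono fun γ h hγ => by rw [h.1 hγ.2])
  · -- pasts already at `D.pt 1`: the future is the constant class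
    have h1 : P D (CurveClass.stopAt F ⁻¹' (S ∩ {c | c.target = D.pt 1}) ∩
        CurveClass.startFrom F ⁻¹' T) = P D (CurveClass.stopAt F ⁻¹' (S ∩ {c | c.target = D.pt 1}) ∩
          {_c | CurveClass.mk (Curve.const (D.pt 1)) ∈ T}) :=
      measure_congr (eventuallyEq_set.2 (hAE.mono fun γ h => by
        simp only [Set.mem_inter_iff, Set.mem_preimage, Set.mem_setOf_eq]
        exact and_congr_right fun hγ => by rw [h.2 hγ.2]))
    have h2 : ∫⁻ γ in CurveClass.stopAt F ⁻¹' (S ∩ {c | c.target = D.pt 1}),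
        Φ (remainingDomain D (γ.stopAt F)) (γ.stopAt F).target (D.pt 1) T ∂P D =
        ∫⁻ _ in CurveClass.stopAt F ⁻¹' (S ∩ {c | c.target = D.pt 1}),
          T.indicator 1 (CurveClass.mk (Curve.const (D.pt 1))) ∂P D :=
      setLIntegral_congr_fun hS₂ fun γ hγ => by
        rw [show (γ.stopAt F).target = D.pt 1 from hγ.2, hΦ, if_pos rfl, Measure.dirac_apply' _ hT]
    rw [h1, h2, setLIntegral_const]
    by_cases hbT : CurveClass.mk (Curve.const (D.pt 1)) ∈ T
    · have h0 : {_c : CurveClass ℂ | CurveClass.mk (Curve.const (D.pt 1)) ∈ T} = Set.univ :=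
        Set.eq_univ_of_forall fun _ => hbT
      rw [Set.indicator_of_mem hbT, Pi.one_apply, one_mul, h0, Set.inter_univ]
    · have h0 : {_c : CurveClass ℂ | CurveClass.mk (Curve.const (D.pt 1)) ∈ T} = ∅ :=
        Set.eq_empty_of_forall_notMem fun _ h => hbT h
      rw [Set.indicator_of_notMem hbT, zero_mul, h0, Set.inter_empty, measure_empty]

end Summit.CriticalPhenomena.SAWScalingLimit.Theorems.AxiomsOfLimitMarkov

end
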